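import Mathlib
import Summits.ValiantsHypothesis.ValiantsHypothesis.Theorems.FeketeSOSCharPSparseSOSApproxShkredovBarrier
import Summits.ValiantsHypothesis.ValiantsHypothesis.Theorems.FeketeSOSCharPSparseSOSStubWindowCounting

/-!
# Crux `FeketeSOS.CharPSparseSOS` (stmt-ValiantsHypothesis-14989) — the wall in one declaration:
the crux implies an additive POWER below the counting bound for weak-Sidon Paley sum-cliques

A *weak-Sidon restricted Paley sum-clique* is a set `Q ⊆ 𝔽_p` whose restricted pair sums `a + b`
(`a ≠ b` in `Q`) are non-zero quadratic residues and pairwise distinct (`a + b = c + d` with `a ≠ b`,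
`c ≠ d` forces `{a, b} = {c, d}`).  Counting gives `C(|Q|, 2) ≤ (p − 1)/2`, i.e. `|Q| ≤ √p + 1/2`, and no
additive improvement of that bound growing with `p` is in print (completion: `|Q| < √p + 3/2`;
Hanson–Petridis/Stepanov: `|Q⁺|·|Q| ≤ (p − 1)/2` for the good-diagonal class only).

`coreSumClique_of_charPSparseSOS` : the crux `CharPSparseSOS` (with its exponent `δ`) implies that every
weak-Sidon restricted Paley sum-clique has `|Q| ≤ √p − p^δ/2 + 9` for all large primes `p` — the
statement (CORE) of the crux memos (`Cruxes/CharPSparseSOS/STRATEGY-CENSUS.md` §0, typed there as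
`Strategist.CoreSumClique`; here its body is inlined verbatim).  Proof: transport `Q` to its set of
representatives `Q' ⊆ [0, p)`; by weak Sidon every residue carries at most one restricted pair of `Q'` and by
the clique property every carried residue is a non-zero quadratic residue, so the Hamming error of
`rQ_far_from_QR_of_charPSparseSOS` (p112874) is exactly the set of uncovered non-zero residues and
`2·#Err ≤ (p − 1) − |Q|(|Q| − 1)`; the nine-square barrier then reads
`p^{1/2+δ} ≤ 3|Q| + (p − 1) − |Q|(|Q| − 1) + 13√p + 13`, i.e. `(|Q| − 2)² ≤ p + 16 + 13√p − p^{1/2+δ}`, and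
`(√p − p^δ/2 + 7)² − (p + 16 + 13√p − p^{1/2+δ}) = (p^δ/2 − 7)² + √p − 16 ≥ 0` for `p ≥ 256`.
So any proof of the crux is, in particular, a proof of (CORE).  (Lead c6 of the crux; `--supports`.)
-/

-- `Summit.ValiantsHypothesis.ValiantsHypothesis.…` is the tree's mandated single-conjunct layout (Sub = Summit).
set_option linter.dupNamespace false

namespace Summit.ValiantsHypothesis.ValiantsHypothesis.Theorems.CharPSparseSOSTwoCusp

open Finset
open Summit.ValiantsHypothesis.ValiantsHypothesis.Theorems.CharPSparseSOSTraceBias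
  (wc_two_card_qr wc_sum_count wc_two_card_pairs)

/-! ## Transport of a weak-Sidon sum-clique to its representatives in `[0, p)` -/

/-- Representatives of a finite subset of `ZMod p` lie in `[0, p)`. -/
theorem csq_image_val_lt {p : ℕ} [Fact p.Prime] (Q : Finset (ZMod p)) :
    ∀ x ∈ Q.image ZMod.val, x < p := by
  intro x hx
  obtain ⟨a, -, rfl⟩ := mem_image.1 hx
  exact ZMod.val_lt a

/-- Taking representatives does not change the cardinality. -/
theorem csq_card_image_val {p : ℕ} [Fact p.Prime] (Q : Finset (ZMod p)) :
    (Q.image ZMod.val).card = Q.card :=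
  card_image_of_injective _ (ZMod.val_injective p)

/-- **Weak Sidon, transported**: every residue `n` carries at most one restricted pair `x < y` of
representatives with `x + y ≡ n (mod p)`. -/
theorem csq_pairCount_le_one {p : ℕ} [Fact p.Prime] (Q : Finset (ZMod p))
    (hsidon : ∀ a ∈ Q, ∀ b ∈ Q, ∀ c ∈ Q, ∀ d ∈ Q, a ≠ b → c ≠ d → a + b = c + d →
      (a = c ∧ b = d) ∨ (a = d ∧ b = c))
    (n : ℕ) :
    (((Q.image ZMod.val) ×ˢ (Q.image ZMod.val)).filter
        (fun ab : ℕ × ℕ => ab.1 < ab.2 ∧ (ab.1 + ab.2) % p = n)).card ≤ 1 := by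
  refine card_le_one.2 fun x hx y hy => ?_
  simp only [mem_filter, mem_product, mem_image] at hx hy
  obtain ⟨⟨⟨a₁, ha₁, hx₁⟩, ⟨a₂, ha₂, hx₂⟩⟩, hxlt, hxn⟩ := hx
  obtain ⟨⟨⟨b₁, hb₁, hy₁⟩, ⟨b₂, hb₂, hy₂⟩⟩, hylt, hyn⟩ := hy
  have hval : ∀ u v : ZMod p, (u + v).val = (u.val + v.val) % p := fun u v => ZMod.val_add u v
  have ha12 : a₁ ≠ a₂ := by
    rintro rfl
    rw [hx₁] at hx₂
    exact (lt_irrefl _ (hx₂ ▸ hxlt))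
  have hb12 : b₁ ≠ b₂ := by
    rintro rfl
    rw [hy₁] at hy₂
    exact (lt_irrefl _ (hy₂ ▸ hylt))
  have hsum : a₁ + a₂ = b₁ + b₂ := by
    apply ZMod.val_injective p
    rw [hval, hval, hx₁, hx₂, hy₁, hy₂, hxn, hyn]
  rcases hsidon a₁ ha₁ a₂ ha₂ b₁ hb₁ b₂ hb₂ ha12 hb12 hsum with ⟨h1, h2⟩ | ⟨h1, h2⟩
  · subst h1; subst h2
    exact Prod.ext (hx₁.symm.trans hy₁) (hx₂.symm.trans hy₂)
  · subst h1; subst h2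
    -- `x.1 = y.2` and `x.2 = y.1`, contradicting `x.1 < x.2` and `y.1 < y.2`
    have e1 : x.1 = y.2 := hx₁.symm.trans hy₂
    have e2 : x.2 = y.1 := hx₂.symm.trans hy₁
    omega

/-- **Sum-clique, transported**: a residue carrying a restricted pair of representatives is a non-zero
quadratic residue. -/
theorem csq_qr_of_pairCount_ne_zero {p : ℕ} [Fact p.Prime] (Q : Finset (ZMod p))
    (hclique : ∀ a ∈ Q, ∀ b ∈ Q, a ≠ b → legendreSym p (a + b).val = 1)
    (n : ℕ)
    (hn : (((Q.image ZMod.val) ×ˢ (Q.image ZMod.val)).filter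
        (fun ab : ℕ × ℕ => ab.1 < ab.2 ∧ (ab.1 + ab.2) % p = n)).card ≠ 0) :
    n ≠ 0 ∧ legendreSym p n = 1 := by
  obtain ⟨x, hx⟩ := card_ne_zero.1 hn
  simp only [mem_filter, mem_product, mem_image] at hx
  obtain ⟨⟨⟨a₁, ha₁, hx₁⟩, ⟨a₂, ha₂, hx₂⟩⟩, hxlt, hxn⟩ := hx
  have ha12 : a₁ ≠ a₂ := by
    rintro rfl
    rw [hx₁] at hx₂
    exact (lt_irrefl _ (hx₂ ▸ hxlt))
  have h := hclique a₁ ha₁ a₂ ha₂ ha12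
  rw [ZMod.val_add, hx₁, hx₂, hxn] at h
  refine ⟨?_, h⟩
  rintro rfl
  rw [Nat.cast_zero, legendreSym.at_zero] at h
  exact zero_ne_one h

/-- **Error count of a weak-Sidon sum-clique.**  For the representatives `Q'` of a weak-Sidon restricted
Paley sum-clique `Q`, the Hamming error `#{n < p : r_{Q'}(n) ≠ 1_QR(n)}` of the approximate Shkredov
barrier satisfies `2·#Err ≤ (p − 1) − (|Q|² − |Q|)`: the error set consists of the uncovered non-zero
quadratic residues, and the `C(|Q|, 2)` restricted pairs cover pairwise distinct non-zero residues. -/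
theorem csq_two_card_err_le {p : ℕ} [Fact p.Prime] (hp2 : p ≠ 2) (Q : Finset (ZMod p))
    (hclique : ∀ a ∈ Q, ∀ b ∈ Q, a ≠ b → legendreSym p (a + b).val = 1)
    (hsidon : ∀ a ∈ Q, ∀ b ∈ Q, ∀ c ∈ Q, ∀ d ∈ Q, a ≠ b → c ≠ d → a + b = c + d →
      (a = c ∧ b = d) ∨ (a = d ∧ b = c)) :
    2 * (((range p).filter (fun n => (((Q.image ZMod.val) ×ˢ (Q.image ZMod.val)).filter
          (fun ab : ℕ × ℕ => ab.1 < ab.2 ∧ (ab.1 + ab.2) % p = n)).card ≠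
            (if n ≠ 0 ∧ legendreSym p n = 1 then 1 else 0))).card : ℤ) ≤
      ((p : ℤ) - 1) - ((Q.card : ℤ) * Q.card - Q.card) := by
  have hp : p.Prime := Fact.out
  set Q' : Finset ℕ := Q.image ZMod.val with hQ'
  set cnt : ℕ → ℕ := fun n => ((Q' ×ˢ Q').filter
      (fun ab : ℕ × ℕ => ab.1 < ab.2 ∧ (ab.1 + ab.2) % p = n)).card with hcnt
  set R : Finset ℕ := (range p).filter (fun n : ℕ => n ≠ 0 ∧ legendreSym p n = 1) with hR
  set G : Finset ℕ := (range p).filter (fun n : ℕ => cnt n = 1) with hG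
  set Err : Finset ℕ := (range p).filter (fun n => cnt n ≠
      (if n ≠ 0 ∧ legendreSym p n = 1 then 1 else 0)) with hErr
  have hle1 : ∀ n, cnt n ≤ 1 := fun n => csq_pairCount_le_one Q hsidon n
  have hqr : ∀ n, cnt n ≠ 0 → n ≠ 0 ∧ legendreSym p n = 1 := fun n hn =>
    csq_qr_of_pairCount_ne_zero Q hclique n hn
  -- the good residues lie in `R`, the error residues lie in `R \ G`
  have hGR : G ⊆ R := by
    intro n hn
    rw [hG, mem_filter] at hn
    rw [hR, mem_filter]
    exact ⟨hn.1, hqr n (by rw [hn.2]; exact one_ne_zero)⟩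
  have hErrR : Err ⊆ R \ G := by
    intro n hn
    rw [hErr, mem_filter] at hn
    rw [mem_sdiff, hR, hG, mem_filter, mem_filter]
    have h01 : cnt n = 0 ∨ cnt n = 1 := by have := hle1 n; omega
    rcases h01 with h0 | h1
    · refine ⟨⟨hn.1, ?_⟩, fun h => by rw [h0] at h; exact zero_ne_one h.2⟩
      by_contra hc
      exact hn.2 (by rw [h0, if_neg hc])
    · exact absurd (by rw [h1, if_pos (hqr n (by rw [h1]; exact one_ne_zero))]) hn.2
  have hcardErr : Err.card + G.card ≤ R.card := by
    have h1 := card_le_card hErrR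
    rw [card_sdiff_of_subset hGR] at h1
    have h2 := card_le_card hGR
    omega
  -- `#G = Σ_n cnt n = #pairs`
  have hGsum : G.card = ∑ n ∈ range p, cnt n := by
    rw [hG, card_filter]
    refine sum_congr rfl fun n _ => ?_
    have h01 : cnt n = 0 ∨ cnt n = 1 := by have := hle1 n; omega
    rcases h01 with h0 | h1
    · rw [h0]; simp
    · rw [h1]; simp
  have hpairs : ∑ n ∈ range p, cnt n = ((Q' ×ˢ Q').filter (fun ab : ℕ × ℕ => ab.1 < ab.2)).card :=
    wc_sum_count p hp.pos Q'
  have htwo := wc_two_card_pairs Q'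
  have hcardQ' : Q'.card = Q.card := csq_card_image_val Q
  have hRcard := wc_two_card_qr p hp2
  -- assemble (in `ℤ`)
  have h1 : (2 : ℤ) * Err.card + 2 * G.card ≤ 2 * R.card := by exact_mod_cast (by omega)
  have h2 : (2 : ℤ) * G.card + Q.card = (Q.card : ℤ) * Q.card := by
    rw [hGsum, hpairs, ← hcardQ']
    exact_mod_cast htwo
  have hR' : (2 : ℤ) * R.card = (p : ℤ) - 1 := hRcard
  linarith

/-! ## The wall: the crux implies (CORE) -/

/-- Real-exponent bookkeeping: `(q − 2)² ≤ p + 16 + 13√p − √p·(2y)` with `y > 0` and `p ≥ 289` forces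
`q ≤ √p − y + 9`. -/
theorem csq_real_bookkeeping (p q y : ℝ) (hp : 289 ≤ p) (hy : 0 < y)
    (h : (q - 2) ^ 2 ≤ p + 16 + 13 * Real.sqrt p - Real.sqrt p * (2 * y)) :
    q ≤ Real.sqrt p - y + 9 := by
  set r := Real.sqrt p with hr
  have hr17 : 17 ≤ r := by
    rw [hr, show (17 : ℝ) = Real.sqrt 289 by
      rw [show (289 : ℝ) = 17 ^ 2 by norm_num, Real.sqrt_sq (by norm_num)]]
    exact Real.sqrt_le_sqrt hp
  have hrr : r ^ 2 = p := by rw [hr, Real.sq_sqrt (by linarith)]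
  rw [← hrr] at h
  have hdiff : (r - y + 7) ^ 2 - (r ^ 2 + 16 + 13 * r - r * (2 * y)) = (y - 7) ^ 2 + r - 16 := by
    ring
  by_cases hc : 0 ≤ r - y + 7
  · -- `(q − 2)² ≤ (r − y + 7)²`
    have hkey : (q - 2) ^ 2 ≤ (r - y + 7) ^ 2 := by nlinarith [sq_nonneg (y - 7)]
    have habs : |q - 2| ≤ |r - y + 7| := sq_le_sq.1 hkey
    rw [abs_of_nonneg hc] at habs
    have := (abs_le.1 habs).2
    linarith
  · -- the right-hand side is negative: impossible
    push Not at hc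
    nlinarith [sq_nonneg (q - 2), sq_nonneg (y - 7)]

/-- **The crux implies (CORE).**  `CharPSparseSOS` (with its exponent `δ`) implies: for all large primes
`p`, every weak-Sidon restricted Paley sum-clique `Q ⊆ 𝔽_p` — restricted pair sums `a + b` (`a ≠ b` in
`Q`) are quadratic residues (`legendreSym p (a+b).val = 1`, in particular non-zero) and pairwise distinct —
has `|Q| ≤ √p − p^δ/2 + 9`.  The conclusion is, verbatim, the body of `Strategist.CoreSumClique` of the
crux's STRATEGY-CENSUS: an additive power below the counting bound `|Q| ≤ √p + 1/2`, for which no technique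
is on record.  Hence every proof of the crux is in particular a proof of (CORE). -/
theorem coreSumClique_of_charPSparseSOS :
    Summit.ValiantsHypothesis.ValiantsHypothesis.Theses.FeketeSOS.CharPSparseSOS →
      ∃ δ : ℝ, 0 < δ ∧ ∃ p₀ : ℕ, ∀ (p : ℕ) [Fact p.Prime], p₀ ≤ p → ∀ Q : Finset (ZMod p),
        (∀ a ∈ Q, ∀ b ∈ Q, a ≠ b → legendreSym p (a + b).val = 1) →
        (∀ a ∈ Q, ∀ b ∈ Q, ∀ c ∈ Q, ∀ d ∈ Q, a ≠ b → c ≠ d → a + b = c + d →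
            (a = c ∧ b = d) ∨ (a = d ∧ b = c)) →
        (Q.card : ℝ) ≤ Real.sqrt p - (p : ℝ) ^ δ / 2 + 9 := by
  intro hcrux
  obtain ⟨δ, hδ, p₁, H⟩ := rQ_far_from_QR_of_charPSparseSOS hcrux
  refine ⟨δ, hδ, max p₁ 289, ?_⟩
  intro p _ hp Q hclique hsidon
  have hprime : p.Prime := Fact.out
  have hp₁ : p₁ ≤ p := le_of_max_le_left hp
  have hp289 : 289 ≤ p := le_of_max_le_right hp
  have hp2 : p ≠ 2 := by omega
  have hpR : (289 : ℝ) ≤ (p : ℝ) := by exact_mod_cast hp289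
  have hp0 : (0 : ℝ) < (p : ℝ) := by linarith
  -- the nine-square barrier for the representatives of `Q`
  have hbar := H p hp₁ (Q.image ZMod.val) (csq_image_val_lt Q)
  rw [csq_card_image_val Q] at hbar
  -- the error count of a weak-Sidon sum-clique
  have herr := csq_two_card_err_le hp2 Q hclique hsidon
  have herrR : 2 * (((range p).filter (fun n => (((Q.image ZMod.val) ×ˢ (Q.image ZMod.val)).filter
          (fun ab : ℕ × ℕ => ab.1 < ab.2 ∧ (ab.1 + ab.2) % p = n)).card ≠
            (if n ≠ 0 ∧ legendreSym p n = 1 then 1 else 0))).card : ℝ) ≤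
      ((p : ℝ) - 1) - ((Q.card : ℝ) * Q.card - Q.card) := by exact_mod_cast herr
  -- `p^{1/2+δ} = √p · p^δ`
  have hsplit : (p : ℝ) ^ (1 / 2 + δ) = Real.sqrt p * (p : ℝ) ^ δ := by
    rw [Real.rpow_add hp0, Real.sqrt_eq_rpow]
  set q : ℝ := (Q.card : ℝ) with hq
  set y : ℝ := (p : ℝ) ^ δ / 2 with hy
  have hy0 : 0 < y := by rw [hy]; positivity
  have hmain : (q - 2) ^ 2 ≤ p + 16 + 13 * Real.sqrt p - Real.sqrt p * (2 * y) := by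
    have e : Real.sqrt p * (2 * y) = (p : ℝ) ^ (1 / 2 + δ) := by rw [hsplit, hy]; ring
    rw [e]
    nlinarith [hbar, herrR]
  have := csq_real_bookkeeping (p : ℝ) q y hpR hy0 hmain
  rw [hy] at this
  linarith

end Summit.ValiantsHypothesis.ValiantsHypothesis.Theorems.CharPSparseSOSTwoCusp
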